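import Summits.CriticalPhenomena.PercolationContinuityZ3.Theses.PercBurnResprinkle
import Summits.CriticalPhenomena.PercolationContinuityZ3.Theorems.PercBurnResprinkleVacantReignitionTransportAux
import Summits.CriticalPhenomena.PercolationContinuityZ3.Theorems.PercBurnResprinkleVacantReignitionTransportAux2
import Literature.Probability.Percolation.PercolationProofs
import Literature.Probability.Percolation.PercolationEvents
import Literature.Probability.Percolation.StaticRenormalizationBlocks
import Literature.Probability.Percolation.BondPercolationSymmetry
import HarnessLib

/-!
# Crux `PercBurnResprinkle.VacantReignition` (stmt-CriticalPhenomena-7203), line `strip-fresh-field-lss`,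
# stub `stub_transport` — the single-aspect engine `E₁` (`k = 1`) implies the registered engine
# `stub_noCagesFat` (`∀ k ≥ 1, ∃ ρ_k < 1`): the star-dust block-refinement transport

Helper file for the crux skeleton `Cruxes/VacantReignition/Lines/strip_fresh_field_lss.lean` (lead
prover-line-stmt-CriticalPhenomena-7203-0).  It proves the registered stub `stub_transport`
VERBATIM.  Notation: `μ = labelMeasure ℤ³`, `μ2 = μ ⊗ μ` on pairs `π = (U, U')` (environment
labels, fresh labels), `I_p(U)` = the union of the infinite clusters of `η_p(U)`, block spacing
`b_L = 2L+1`, centres `c_L x = b_L x`, window radius `blockR L k = (k+2) b_L - k`,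
`VAC(L,k,p,U)(x) :⟺ (c_L x + B(blockR L k)) ∩ I_p(U) = ∅`, `DUST(L,ρ,U')(x) :⟺
U'({c_L x, c_L x + e₀}) ≤ ρ`, `PERC(S) :⟺` block `0` lies in an infinite nearest-neighbour cluster
of blocks of `S`.

* `E₁ := ∃ ρ < 1, ∀ L₀, ∃ L ≥ L₀, ∃ p > p_c, 0 < μ2{PERC{VAC(L,1,p,U) ∧ DUST(L,ρ,U')}}`;
* `NC := ∀ k ≥ 1, ∃ ρ < 1, ∀ L₀, ∃ L ≥ L₀, ∃ p > p_c, 0 < μ2{PERC{VAC(L,k,p,U) ∧ DUST(L,ρ,U')}}`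
  (= the registered engine `stub_noCagesFat` of the line).

`stub_transport : E₁ → NC`.  Since bigger `k` means FEWER vacant blocks at a fixed scale, nothing
transports at fixed `L`; it is the freedom in `L` (refine the block lattice by `≈ k + 2`) plus a
thinning of the dust that does it.

## The argument

Fix `k ≥ 1`; `E₁` gives `ρ₁`; put `r = max ρ₁ 0 ∈ [0,1)`, `M = 2k + 4`, `ρ_k = r^{1/3M} < 1`.  Given
`L₀`, apply `E₁` with `L₀' = (k+2)(L₀ + 3k + 6)`: some `L' ≥ L₀'`, `p > p_c` with
`0 < μ2(B)`, `B = {PERC{VAC(L',1,p,U) ∧ DUST(L',ρ₁,U')}}` (COARSE lattice, spacing `b' = 2L'+1`,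
window `3b' - 1`).  FINE lattice: `L = ⌊L'/(k+2)⌋ ≥ L₀`, spacing `b = 2L+1`, window
`(k+2) b - k`; the integer arithmetic `2L + L' + blockR L k ≤ blockR L' 1`,
`b' + 2L < (M+1) b`, `3M ≤ 2L` holds.  ROUNDING MAP `f(t) = ⌊(b' t + L)/b⌋`, `|b f(t) - b' t| ≤ L`,
block map `y(a)_l = f(a_l)` (injective, `y(0) = 0`, `y(a + eᵢ) = y(a) + n(a,i) eᵢ` with
`1 ≤ n(a,i) = f(aᵢ+1) - f(aᵢ) ≤ M`), and the dust SLOTS `σ(a,i,j)`, `i ∈ Fin 3`, `j < M`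
(companion file `…TransportAux.lean`).  Then

1. `μ2(B) ≤ μ2(B₊)`, `B₊` the same event with `ρ₁ ↦ r` (monotonicity);
2. `μ2(B₊) = μ2(A)`, `A = {PERC{VAC(L',1,p,U) ∧ SLOT(U')}}`, `SLOT(U')(a) :⟺ U'(σ(a,i,j)) ≤ ρ_k`
   for all `3M` slots of `a`: for each FIXED environment `U` the coarse dust field
   `(DUST(L',r,U')(a))_a` and the slot field `(SLOT(U')(a))_a` are both i.i.d. Bernoulli(`r`)
   (the slots of distinct blocks are `3M`-sets of DISTINCT label coordinates,
   `vacantReignition_tr_slot_injective`; cylinder probabilities `r^{|G|} = (ρ_k^{3M})^{|G|}`,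
   `vacantReignition_tr_measure_biInter_dust`), so the two random block sets have the same law
   (`vacantReignition_tr_law_transfer`, π-λ) and the measurable functional
   `S ↦ PERC(VAC_U ∩ S)` has the same probability; integrate over `U` (Fubini,
   `vacantReignition_dom_prod_real_le`);
3. `A ⊆ C = {PERC{VAC(L,k,p,U) ∧ DUST(L,ρ_k,U')}}` PATHWISE: along the segment from `y(a)` to
   `y(a + eᵢ)` between two adjacent coarse blocks of `VAC' ∧ SLOT`, every fine block is
   `(L,k)`-vacant (window containment, `vacantReignition_tr_window`) and `ρ_k`-dusted (its dust
   edge is a slot of `a` or the centre slot of `a + eᵢ`, `vacantReignition_tr_slot_cover`), so the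
   coarse infinite cluster of `0` lifts to a fine one (`vacantReignition_tr_fine_percolates`).

Hence `0 < μ2(B) ≤ μ2(C)`, which is `NC` at `(k, ρ_k, L, p)`.  No new definitions.

## References

* G. Grimmett, *Percolation*, 2nd ed., Springer 1999, §1.3 p. 11 (coupled labels), §7.4
  pp. 178–181 (static block renormalisation) [GrimmettPercolation1999].
* T. M. Liggett, R. H. Schonmann, A. M. Stacey, *Domination by product measures*, Ann. Probab. 25
  (1997) 71–95, Lemma 1.1 [LiggettSchonmannStacey1997].
-/

noncomputable section

namespace Summit.CriticalPhenomena.PercolationContinuityZ3.Theorems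

open MeasureTheory ProbabilityTheory Literature.Probability.Percolation Literature.Probability.LatticeModels
open scoped ENNReal

/-! ### The stub -/

/-- **Stub `stub_transport`** (the registered statement, verbatim): the single-aspect engine
`E₁` (`k = 1`: for some `ρ < 1`, at arbitrarily large scales `L` and some `p > p_c`, block `0`
percolates with positive `μ ⊗ μ`-probability in the blocks `x` whose window
`(2L+1)x + B(blockR L 1)` misses every infinite `η_p`-cluster of the environment labels and whose
dust label `U'({(2L+1)x, (2L+1)x + e₀})` is `≤ ρ`) implies the registered engine `stub_noCagesFat`
(the same for every aspect `k ≥ 1`, with `ρ = ρ_k`).  Proof: star-dust block-refinement transport —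
refine the coarse lattice of an `E₁`-witness `(L', p)` by the rounding map `f(t) = ⌊(b' t + L)/b⌋`,
`L = ⌊L'/(k+2)⌋`; replace the coarse dust field by the equidistributed slot field (equality of laws
for each fixed environment, Fubini); conclude pathwise by window containment and percolation along
the subdivision.  See the module docstring. -/
theorem stub_transport :
    (∃ ρ : ℝ, ρ < 1 ∧ ∀ L₀ : ℕ, ∃ L : ℕ, L₀ ≤ L ∧ ∃ p : ℝ,
    criticalProb (zdGraph 3) (0 : Fin 3 → ℤ) < p ∧
    0 < ((labelMeasure (Fin 3 → ℤ)).prod (labelMeasure (Fin 3 → ℤ))).real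
      {π : (Sym2 (Fin 3 → ℤ) → ℝ) × (Sym2 (Fin 3 → ℤ) → ℝ) |
        (openCluster {E : Sym2 (Fin 3 → ℤ) | E ∈ (zdGraph 3).edgeSet ∧ ∀ x ∈ E,
            (∀ y ∈ (↑(box 3 (blockR L 1)) : Set (Fin 3 → ℤ)),
              ¬ (openCluster (configOfLabels p π.1 (zdGraph 3)) (((2 * L + 1 : ℕ) : ℤ) • x + y)).Infinite) ∧
            π.2 (s(((2 * L + 1 : ℕ) : ℤ) • x, ((2 * L + 1 : ℕ) : ℤ) • x + Pi.single 0 1)) ≤ ρ}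
          (0 : Fin 3 → ℤ)).Infinite}) →
    ∀ k : ℕ, 1 ≤ k → ∃ ρ : ℝ, ρ < 1 ∧ ∀ L₀ : ℕ, ∃ L : ℕ, L₀ ≤ L ∧ ∃ p : ℝ,
    criticalProb (zdGraph 3) (0 : Fin 3 → ℤ) < p ∧
    0 < ((labelMeasure (Fin 3 → ℤ)).prod (labelMeasure (Fin 3 → ℤ))).real
      {π : (Sym2 (Fin 3 → ℤ) → ℝ) × (Sym2 (Fin 3 → ℤ) → ℝ) |
        (openCluster {E : Sym2 (Fin 3 → ℤ) | E ∈ (zdGraph 3).edgeSet ∧ ∀ x ∈ E,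
            (∀ y ∈ (↑(box 3 (blockR L k)) : Set (Fin 3 → ℤ)),
              ¬ (openCluster (configOfLabels p π.1 (zdGraph 3)) (((2 * L + 1 : ℕ) : ℤ) • x + y)).Infinite) ∧
            π.2 (s(((2 * L + 1 : ℕ) : ℤ) • x, ((2 * L + 1 : ℕ) : ℤ) • x + Pi.single 0 1)) ≤ ρ}
          (0 : Fin 3 → ℤ)).Infinite} := by
  intro hE1 k hk
  obtain ⟨ρ₁, hρ₁, hE⟩ := hE1
  have hprob := isProbabilityMeasure_labelMeasure (Fin 3 → ℤ)
  -- parameters depending on `k` only: slots per direction `M`, dust density `ρk = r ^ (1 / 3M)`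
  set M : ℕ := 2 * k + 4 with hM
  set r : ℝ := max ρ₁ 0 with hr
  have hr0 : 0 ≤ r := le_max_right _ _
  have hr1 : r < 1 := max_lt hρ₁ one_pos
  set ρk : ℝ := r ^ ((3 * M : ℕ) : ℝ)⁻¹ with hρk
  have hρk0 : 0 ≤ ρk := Real.rpow_nonneg hr0 _
  have hρk1 : ρk < 1 := Real.rpow_lt_one hr0 hr1 (by positivity)
  have hρkpow : ρk ^ (3 * M) = r := Real.rpow_inv_natCast_pow hr0 (by omega)
  refine ⟨ρk, hρk1, fun L₀ => ?_⟩
  obtain ⟨L', hL', p, hp, hpos⟩ := hE ((k + 2) * (L₀ + 3 * k + 6))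
  -- the fine scale `L = ⌊L' / (k+2)⌋` and its arithmetic
  set L : ℕ := L' / (k + 2) with hL
  have hk2 : 0 < k + 2 := by omega
  have hLlo : L₀ + 3 * k + 6 ≤ L := (Nat.le_div_iff_mul_le hk2).2 (by rw [mul_comm]; exact hL')
  have hLL' : L ≤ L' := Nat.div_le_self _ _
  have hkL : (k + 2) * L ≤ L' := Nat.mul_div_le L' (k + 2)
  have hL'lt : L' < (k + 2) * (L + 1) := Nat.lt_mul_div_succ L' hk2
  have hR : 2 * L + L' + blockR L k ≤ blockR L' 1 := by unfold blockR; nlinarith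
  have hMb : 2 * L' + 1 + 2 * L < (M + 1) * (2 * L + 1) := by rw [hM]; nlinarith
  have hML : 3 * M ≤ 2 * L := by omega
  refine ⟨L, by omega, p, hp, ?_⟩
  -- the rounding map `f`, block map `y`, steps `n` and slots `σ`
  set N : ℤ := ((2 * L + 1 : ℕ) : ℤ) with hN
  set N' : ℤ := ((2 * L' + 1 : ℕ) : ℤ) with hN'
  set f : ℤ → ℤ := fun t => (N' * t + L) / N with hf
  have hfr : ∀ t : ℤ, |N * f t - N' * t| ≤ L := fun t => vacantReignition_tr_round L L' t
  have hmono : StrictMono f := vacantReignition_tr_strictMono hfr hLL'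
  set y : (Fin 3 → ℤ) → (Fin 3 → ℤ) := fun a l => f (a l) with hy
  have hyl : ∀ a l, y a l = f (a l) := fun _ _ => rfl
  set n : (Fin 3 → ℤ) → Fin 3 → ℕ := fun a i => (f (a i + 1) - f (a i)).toNat with hn
  have hncast : ∀ a i, ((n a i : ℕ) : ℤ) = f (a i + 1) - f (a i) := fun a i =>
    Int.toNat_of_nonneg (sub_nonneg.2 (hmono.monotone (by omega)))
  have hstep : ∀ a i, y (a + Pi.single i 1) = y a + Pi.single i ((n a i : ℕ) : ℤ) := by
    intro a i
    ext l
    rw [hncast]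
    simp only [hy, Pi.add_apply]
    by_cases hl : l = i
    · subst hl; simp
    · simp [Pi.single_eq_of_ne hl]
  have hy0 : y 0 = 0 := funext fun l => vacantReignition_tr_f_zero hfr
  have hinj : Function.Injective y := fun a a' h => funext fun l => hmono.injective (congrFun h l)
  set σ : (Fin 3 → ℤ) → Fin 3 → ℕ → Sym2 (Fin 3 → ℤ) := fun a i j =>
    if (1 ≤ j ∨ i = 0) ∧ (j : ℤ) < f (a i + 1) - f (a i) then
      s(N • (y a + Pi.single i (j : ℤ)), N • (y a + Pi.single i (j : ℤ)) + Pi.single 0 1)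
    else
      s(N • y a + Pi.single 1 ((3 * j + (i : ℕ) + 1 : ℕ) : ℤ),
        N • y a + Pi.single 1 ((3 * j + (i : ℕ) + 1 : ℕ) : ℤ) + Pi.single 1 1) with hσ
  have hσ' : ∀ a i j, σ a i j =
      if (1 ≤ j ∨ i = 0) ∧ (j : ℤ) < f (a i + 1) - f (a i) then
        s(N • (y a + Pi.single i (j : ℤ)), N • (y a + Pi.single i (j : ℤ)) + Pi.single 0 1)
      else
        s(N • y a + Pi.single 1 ((3 * j + (i : ℕ) + 1 : ℕ) : ℤ),
          N • y a + Pi.single 1 ((3 * j + (i : ℕ) + 1 : ℕ) : ℤ) + Pi.single 1 1) := fun _ _ _ => rfl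
  -- the events
  set μ : Measure (Sym2 (Fin 3 → ℤ) → ℝ) := labelMeasure (Fin 3 → ℤ) with hμ
  set Φ : Set (Fin 3 → ℤ) → Prop := fun S =>
    (openCluster {E : Sym2 (Fin 3 → ℤ) | E ∈ (zdGraph 3).edgeSet ∧ ∀ z ∈ E, z ∈ S} (0 : Fin 3 → ℤ)).Infinite
    with hΦ
  set V' : (Fin 3 → ℤ) → Set (Sym2 (Fin 3 → ℤ) → ℝ) := fun x =>
    {U | ∀ w ∈ (↑(box 3 (blockR L' 1)) : Set (Fin 3 → ℤ)),
      ¬ (openCluster (configOfLabels p U (zdGraph 3)) (N' • x + w)).Infinite} with hV'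
  set Y : ℝ → (Fin 3 → ℤ) → Set (Sym2 (Fin 3 → ℤ) → ℝ) := fun t x =>
    {U' | U' (s(N' • x, N' • x + Pi.single 0 1)) ≤ t} with hY
  set X : (Fin 3 → ℤ) → Set (Sym2 (Fin 3 → ℤ) → ℝ) := fun x =>
    {U' | ∀ i : Fin 3, ∀ j : ℕ, j < M → U' (σ x i j) ≤ ρk} with hX
  have hΦm : MeasurableSet {S | Φ S} := vacantReignition_dom_measurableSet_blockPerc
  have hV'm : ∀ x, MeasurableSet (V' x) := fun x => vacantReignition_dom_measurableSet_vac p (N' • x) _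
  have hYm : ∀ t x, MeasurableSet (Y t x) := fun t x => vacantReignition_dom_measurableSet_dust _ t
  have hXm : ∀ x, MeasurableSet (X x) := fun x =>
    measurableSet_setOf.2 <| Measurable.forall fun i => Measurable.forall fun j =>
      measurable_const.imp (measurableSet_setOf.1 (vacantReignition_dom_measurableSet_dust (σ x i j) ρk))
  -- fine goodness along the segments between adjacent coarse good blocks (pathwise)
  have hgood : ∀ (U U' : Sym2 (Fin 3 → ℤ) → ℝ) (a : Fin 3 → ℤ) (i : Fin 3),
      (U ∈ V' a ∧ U' ∈ X a) → (U ∈ V' (a + Pi.single i 1) ∧ U' ∈ X (a + Pi.single i 1)) →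
      ∀ j : ℕ, j ≤ n a i →
        (∀ w ∈ (↑(box 3 (blockR L k)) : Set (Fin 3 → ℤ)),
          ¬ (openCluster (configOfLabels p U (zdGraph 3)) (N • (y a + Pi.single i (j : ℤ)) + w)).Infinite) ∧
        U' (s(N • (y a + Pi.single i (j : ℤ)), N • (y a + Pi.single i (j : ℤ)) + Pi.single 0 1)) ≤ ρk := by
    intro U U' a i hPa hPb j hj
    have hjz : (j : ℤ) ≤ f (a i + 1) - f (a i) := by rw [← hncast]; exact_mod_cast hj
    refine ⟨vacantReignition_tr_window hfr hR y hyl a i j hjz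
      (fun v => ¬ (openCluster (configOfLabels p U (zdGraph 3)) v).Infinite) hPa.1 hPb.1, ?_⟩
    by_cases hjlt : (j : ℤ) < f (a i + 1) - f (a i)
    · obtain ⟨i', j', hj'M, hσeq⟩ := vacantReignition_tr_slot_cover hfr hLL' hMb y σ hσ' a i j hjlt
      have := hPa.2 i' j' hj'M
      rwa [hσeq] at this
    · have hjeq : (j : ℤ) = f (a i + 1) - f (a i) := le_antisymm hjz (not_lt.1 hjlt)
      have hpt : y a + Pi.single i (j : ℤ) = y (a + Pi.single i 1) := by
        rw [hstep, hncast, ← hjeq]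
      obtain ⟨i', j', hj'M, hσeq⟩ := vacantReignition_tr_slot_cover hfr hLL' hMb y σ hσ'
        (a + Pi.single i 1) 0 0 (by exact_mod_cast sub_pos.2 (hmono (lt_add_one _)))
      have := hPb.2 i' j' hj'M
      rw [hσeq] at this
      rw [hpt]
      simpa only [Nat.cast_zero, Pi.single_zero, add_zero] using this
  -- Step 1: enlarge the dust density `ρ₁ ↦ r = max ρ₁ 0`
  have h1 : (μ.prod μ).real {π | Φ {x | π.1 ∈ V' x ∧ π.2 ∈ Y ρ₁ x}} ≤
      (μ.prod μ).real {π | Φ {x | π.1 ∈ V' x ∧ π.2 ∈ Y r x}} := by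
    refine measureReal_mono (fun π hπ => ?_)
    exact vacantReignition_dom_blockPerc_mono
      (fun x hx => ⟨hx.1, le_trans (b := ρ₁) hx.2 (le_max_left _ _)⟩) hπ
  -- Step 2: the coarse dust field and the slot field have the same law; Fubini over `U`
  have h2 : (μ.prod μ).real {π | Φ {x | π.1 ∈ V' x ∧ π.2 ∈ Y r x}} ≤
      (μ.prod μ).real {π | Φ {x | π.1 ∈ V' x ∧ π.2 ∈ X x}} := by
    refine vacantReignition_dom_prod_real_le μ μ Φ hΦm V' X (Y r) hV'm hXm (hYm r) fun U => le_of_eq ?_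
    refine vacantReignition_tr_law_transfer μ Φ hΦm (fun x => U ∈ V' x) X (Y r) hXm (hYm r) fun G => ?_
    rw [show (⋂ x ∈ G, Y r x) =
        ⋂ x ∈ G, {U' : Sym2 (Fin 3 → ℤ) → ℝ | U' (s(N' • x, N' • x + Pi.single 0 1)) ≤ r} from rfl,
      vacantReignition_tr_measure_biInter_dust (fun x : Fin 3 → ℤ => s(N' • x, N' • x + Pi.single 0 1))
        (vacantReignition_dom_dustEdge_injective L') hr0 hr1.le G]
    have hslot : (⋂ x ∈ G, X x) = ⋂ v ∈ G ×ˢ (Finset.univ : Finset (Fin 3 × Fin M)),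
        {U' : Sym2 (Fin 3 → ℤ) → ℝ | U' (σ v.1 v.2.1 v.2.2) ≤ ρk} := by
      ext U'
      simp only [Set.mem_iInter, Set.mem_setOf_eq, Finset.mem_product, Finset.mem_univ, and_true, hX]
      constructor
      · rintro h ⟨x, i, j⟩ hx
        exact h x hx i j j.isLt
      · intro h x hx i j hj
        exact h ⟨x, i, ⟨j, hj⟩⟩ hx
    have hσinj : Function.Injective fun v : (Fin 3 → ℤ) × (Fin 3 × Fin M) => σ v.1 v.2.1 v.2.2 := by
      rintro ⟨x, i, j⟩ ⟨x', i', j'⟩ h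
      obtain ⟨h1, h2, h3⟩ :=
        vacantReignition_tr_slot_injective hfr hLL' hML y hyl σ hσ' j.isLt j'.isLt h
      subst h1; subst h2
      obtain rfl : j = j' := Fin.ext h3
      rfl
    rw [hslot, vacantReignition_tr_measure_biInter_dust _ hσinj hρk0 hρk1.le, Finset.card_product,
      Finset.card_univ, Fintype.card_prod, Fintype.card_fin, Fintype.card_fin, mul_comm G.card (3 * M),
      pow_mul, ← ENNReal.ofReal_pow hρk0, hρkpow]
  -- Step 3: pathwise, coarse percolation of {vacant ∧ slots} gives fine percolation of {vacant ∧ dust}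
  refine hpos.trans_le (h1.trans (h2.trans (measureReal_mono fun π hπ => ?_)))
  exact vacantReignition_tr_fine_percolates y hy0 hinj n hstep (fun x => π.1 ∈ V' x ∧ π.2 ∈ X x)
    (fun z => (∀ w ∈ (↑(box 3 (blockR L k)) : Set (Fin 3 → ℤ)),
      ¬ (openCluster (configOfLabels p π.1 (zdGraph 3)) (N • z + w)).Infinite) ∧
      π.2 (s(N • z, N • z + Pi.single 0 1)) ≤ ρk) hπ (hgood π.1 π.2)

end Summit.CriticalPhenomena.PercolationContinuityZ3.Theorems

end
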